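import Summits.HodgeConjecture.HodgeConjecture.Theses.GmtVisibleFractionBootstrap
import HarnessLib

/-!
# Route `GmtVisibleFractionBootstrap`, support `ConvexBootstrap` (stmt-HodgeConjecture-18333)

The finite-dimensional convex-geometry bootstrap of Lawson's programme (Lawson 1975, PSPM 27 §5; the
planner's item text): in a finite-dimensional real normed space let `P` be a closed cone on which a linear
functional `ℓ` is non-negative and vanishes only at `0`, `Psef ⊆ P` a closed cone stable under addition and
containing `0`, `K ⊆ P` a cone and `D ⊆ K` with `K ⊆ closure D`.  If some fixed fraction `c > 0` of every
`y ∈ D` is *visible* in `Psef` — for every `ε > 0` there is `e ∈ Psef` with `y - e ∈ closure K` and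
`ℓ e ≥ c · ℓ y - ε` — then `K ⊆ Psef`.

## Proof

* `convexBootstrap_exists_pos_mul_norm_le`: on a closed cone `P` with `ℓ ≥ 0` and `ℓ⁻¹(0) ∩ P = {0}`
  the functional controls the norm, `a‖x‖ ≤ ℓ x` (`a > 0`), by compactness of `P ∩` unit sphere.
* Main argument (`convexBootstrap_proof`): let `M := sup {dist(y, Psef) : y ∈ closure K, ℓ y ≤ 1}` (finite by
  the norm control, as `0 ∈ Psef`).  Cone scaling gives `dist(r, Psef) ≤ M · ℓ r` on `closure K`.  For
  `z ∈ closure K` with `ℓ z ≤ 1`, approximate `z` by `y ∈ D`, split `y = e + r` with `e ∈ Psef`, `r ∈ closure K`,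
  `ℓ r ≤ max(1 - c, 0) · ℓ y + ε`; translation invariance (`Psef + e ⊆ Psef`) gives
  `dist(y, Psef) ≤ dist(r, Psef) ≤ M ℓ r`, whence `M ≤ max(1 - c, 0) · M`, so `M = 0`, so `closure K ⊆ Psef`.
  Convexity and openness hypotheses of the item are not needed.
-/

set_option linter.dupNamespace false

namespace Summit.HodgeConjecture.HodgeConjecture.Theorems

open Set Metric

/-- **Norm control on a pointed closed cone.** If `P` is a closed cone (stable under non-negative scaling) in a
finite-dimensional real normed space and the continuous linear functional `ℓ` is non-negative on `P` and vanishes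
on `P` only at `0`, then `a · ‖x‖ ≤ ℓ x` on `P` for some `a > 0` (minimum of `ℓ` on the compact set
`P ∩ sphere 0 1`). -/
theorem convexBootstrap_exists_pos_mul_norm_le
    {W : Type} [NormedAddCommGroup W] [NormedSpace ℝ W] [FiniteDimensional ℝ W]
    (ℓ : W →L[ℝ] ℝ) {P : Set W} (hPc : IsClosed P)
    (hPcone : ∀ x ∈ P, ∀ t : ℝ, 0 ≤ t → t • x ∈ P)
    (hℓP : ∀ x ∈ P, 0 ≤ ℓ x) (hℓ0 : ∀ x ∈ P, ℓ x = 0 → x = 0) :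
    ∃ a : ℝ, 0 < a ∧ ∀ x ∈ P, a * ‖x‖ ≤ ℓ x := by
  set C : Set W := P ∩ Metric.sphere (0 : W) 1 with hC_def
  have hCc : IsCompact C := (isCompact_sphere (0 : W) 1).inter_left hPc
  -- normalising a non-zero vector of `P` lands in `C`
  have hnormal : ∀ x ∈ P, x ≠ 0 → ‖x‖⁻¹ • x ∈ C := by
    intro x hx hx0
    refine ⟨hPcone x hx _ (inv_nonneg.2 (norm_nonneg x)), ?_⟩
    rw [mem_sphere_zero_iff_norm, norm_smul, norm_inv, norm_norm,
      inv_mul_cancel₀ (norm_ne_zero_iff.2 hx0)]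
  by_cases hCne : C.Nonempty
  · obtain ⟨x₀, hx₀C, hmin⟩ := hCc.exists_isMinOn hCne ℓ.continuous.continuousOn
    rw [isMinOn_iff] at hmin
    have hx₀P : x₀ ∈ P := hx₀C.1
    have hx₀ne : x₀ ≠ 0 := by
      have h1 : ‖x₀‖ = 1 := mem_sphere_zero_iff_norm.1 hx₀C.2
      intro h
      rw [h, norm_zero] at h1
      exact zero_ne_one h1
    have ha : 0 < ℓ x₀ :=
      lt_of_le_of_ne (hℓP x₀ hx₀P) (fun h ↦ hx₀ne (hℓ0 x₀ hx₀P h.symm))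
    refine ⟨ℓ x₀, ha, fun x hx ↦ ?_⟩
    by_cases hx0 : x = 0
    · simp [hx0]
    · have hle : ℓ x₀ ≤ ℓ (‖x‖⁻¹ • x) := hmin _ (hnormal x hx hx0)
      rw [map_smul, smul_eq_mul] at hle
      have hnpos : 0 < ‖x‖ := norm_pos_iff.2 hx0
      calc ℓ x₀ * ‖x‖ ≤ (‖x‖⁻¹ * ℓ x) * ‖x‖ := mul_le_mul_of_nonneg_right hle hnpos.le
        _ = ℓ x := by
            rw [mul_comm, ← mul_assoc, mul_inv_cancel₀ hnpos.ne', one_mul]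
  · refine ⟨1, one_pos, fun x hx ↦ ?_⟩
    have hx0 : x = 0 := by
      by_contra h
      exact hCne ⟨_, hnormal x hx h⟩
    simp [hx0]

/-- **Lawson's convex bootstrap** (item stmt-HodgeConjecture-18333, route `GmtVisibleFractionBootstrap`,
support `ConvexBootstrap`): if a fixed positive fraction of every element of a dense subset `D` of the cone
`K ⊆ P` is visible in the closed additive cone `Psef ⊆ P` (with error in `closure K`), then `K ⊆ Psef`. -/
theorem convexBootstrap_proof :
    Summit.HodgeConjecture.HodgeConjecture.Theses.GmtVisibleFractionBootstrap.ConvexBootstrap := by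
  intro W _ _ _ ℓ P Psef K D hPc _ hPcone hℓP hℓ0 hSc _ h0S hSadd hScone _ _ _ hKcone hKP hDK hKD hvis
  obtain ⟨c, hc, hvis⟩ := hvis
  obtain ⟨a, ha, haP⟩ := convexBootstrap_exists_pos_mul_norm_le ℓ hPc hPcone hℓP hℓ0
  -- `closure K`: inside `P`, inside `closure D`, a cone
  have hK'P : closure K ⊆ P := closure_minimal hKP hPc
  have hK'D : closure K ⊆ closure D := closure_minimal hKD isClosed_closure
  have hK'cone : ∀ x ∈ closure K, ∀ t : ℝ, 0 < t → t • x ∈ closure K := fun x hx t ht ↦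
    map_mem_closure (continuous_const_smul t) hx (fun y hy ↦ hKcone y hy t ht)
  have hSne : Psef.Nonempty := ⟨0, h0S⟩
  -- the supremum `M` of the distance to `Psef` over `{y ∈ closure K | ℓ y ≤ 1}`
  set S : Set W := {y | y ∈ closure K ∧ ℓ y ≤ 1} with hS_def
  set f : W → ℝ := fun y ↦ Metric.infDist y Psef with hf_def
  have hbdd : BddAbove (f '' S) := by
    refine ⟨a⁻¹, ?_⟩
    rintro _ ⟨y, hy, rfl⟩
    have hyP : y ∈ P := hK'P hy.1
    calc f y ≤ dist y 0 := Metric.infDist_le_dist_of_mem h0S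
      _ = ‖y‖ := dist_zero_right y
      _ = a⁻¹ * (a * ‖y‖) := by rw [← mul_assoc, inv_mul_cancel₀ ha.ne', one_mul]
      _ ≤ a⁻¹ * ℓ y := by gcongr; exact haP y hyP
      _ ≤ a⁻¹ * 1 := by gcongr; exact hy.2
      _ = a⁻¹ := mul_one _
  set M : ℝ := sSup (f '' S) with hM_def
  have hfM : ∀ y ∈ S, f y ≤ M := fun y hy ↦ le_csSup hbdd (mem_image_of_mem f hy)
  have hM0 : 0 ≤ M :=
    Real.sSup_nonneg (by rintro _ ⟨y, -, rfl⟩; exact Metric.infDist_nonneg)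
  -- scaling: `f r ≤ M * ℓ r` on `closure K`
  have hscale : ∀ r ∈ closure K, f r ≤ M * ℓ r := by
    intro r hr
    have hrP : r ∈ P := hK'P hr
    rcases (hℓP r hrP).eq_or_lt with h0 | hpos
    · have hr0 : r = 0 := hℓ0 r hrP h0.symm
      have : f r = 0 := by rw [hr0]; exact Metric.infDist_zero_of_mem h0S
      rw [this, ← h0, mul_zero]
    · set u : W := (ℓ r)⁻¹ • r with hu_def
      have huS : u ∈ S := ⟨hK'cone r hr _ (inv_pos.2 hpos), by
        rw [hu_def, map_smul, smul_eq_mul, inv_mul_cancel₀ hpos.ne']⟩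
      have hfu : f u ≤ M := hfM u huS
      have hru : (ℓ r) • u = r := by
        rw [hu_def, smul_smul, mul_inv_cancel₀ hpos.ne', one_smul]
      have key : f r ≤ ℓ r * f u := by
        refine le_of_forall_pos_le_add fun η hη ↦ ?_
        have hη' : 0 < η / ℓ r := div_pos hη hpos
        obtain ⟨s, hs, hds⟩ :=
          (Metric.infDist_lt_iff hSne).1 (lt_add_of_pos_right (f u) hη')
        have hs' : (ℓ r) • s ∈ Psef := hScone s hs _ hpos.le
        calc f r ≤ dist r ((ℓ r) • s) := Metric.infDist_le_dist_of_mem hs'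
          _ = dist ((ℓ r) • u) ((ℓ r) • s) := by rw [hru]
          _ = ℓ r * dist u s := by rw [dist_smul₀, Real.norm_of_nonneg hpos.le]
          _ ≤ ℓ r * (f u + η / ℓ r) := by gcongr
          _ = ℓ r * f u + η := by field_simp
      calc f r ≤ ℓ r * f u := key
        _ ≤ ℓ r * M := by gcongr
        _ = M * ℓ r := mul_comm _ _
  -- the contraction: every value of `f` on `S` is at most `θ * M`, `θ := max (1 - c) 0 < 1`
  set θ : ℝ := max (1 - c) 0 with hθ_def
  have hθ0 : 0 ≤ θ := le_max_right _ _
  have hθ1 : θ < 1 := max_lt (by linarith) one_pos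
  have hcontr : ∀ z ∈ S, f z ≤ θ * M := by
    intro z hz
    refine le_of_forall_pos_le_add fun ε' hε' ↦ ?_
    have hA : 0 < 1 + M * ‖ℓ‖ + M := by positivity
    set δ : ℝ := ε' / (2 * (1 + M * ‖ℓ‖ + M)) with hδ_def
    have hδ : 0 < δ := by positivity
    have hδA : δ * (1 + M * ‖ℓ‖ + M) = ε' / 2 := by
      rw [hδ_def]; field_simp
    -- approximate `z` by `y ∈ D`
    obtain ⟨y, hyD, hzy⟩ := Metric.mem_closure_iff.1 (hK'D hz.1) δ hδ
    have hyK' : y ∈ closure K := subset_closure (hDK hyD)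
    have hyP : y ∈ P := hK'P hyK'
    -- the visible fraction of `y`
    obtain ⟨e, he, hreK, hℓe⟩ := hvis y hyD δ hδ
    have hrP : y - e ∈ P := hK'P hreK
    have hℓr0 : 0 ≤ ℓ (y - e) := hℓP _ hrP
    have hℓy0 : 0 ≤ ℓ y := hℓP y hyP
    -- `ℓ y ≤ 1 + ‖ℓ‖ δ`
    have hℓy : ℓ y ≤ 1 + ‖ℓ‖ * δ := by
      have h1 : ℓ y = ℓ z + ℓ (y - z) := by rw [map_sub]; ring
      have h2 : ℓ (y - z) ≤ ‖ℓ‖ * δ := by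
        calc ℓ (y - z) ≤ ‖ℓ (y - z)‖ := Real.le_norm_self _
          _ ≤ ‖ℓ‖ * ‖y - z‖ := ℓ.le_opNorm _
          _ ≤ ‖ℓ‖ * δ := by
              gcongr
              rw [← dist_eq_norm, dist_comm]
              exact hzy.le
      linarith [hz.2]
    -- `ℓ (y - e) ≤ θ ℓ y + δ`
    have hℓr : ℓ (y - e) ≤ θ * ℓ y + δ := by
      have h1 : ℓ (y - e) = ℓ y - ℓ e := by rw [map_sub]
      have h2 : (1 - c) * ℓ y ≤ θ * ℓ y := mul_le_mul_of_nonneg_right (le_max_left _ _) hℓy0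
      linarith
    -- translation by `e ∈ Psef`: `f y ≤ f (y - e)`
    have hfy : f y ≤ f (y - e) := by
      refine le_of_forall_pos_le_add fun η hη ↦ ?_
      obtain ⟨s, hs, hds⟩ :=
        (Metric.infDist_lt_iff hSne).1 (lt_add_of_pos_right (f (y - e)) hη)
      have hes : e + s ∈ Psef := hSadd e he s hs
      calc f y ≤ dist y (e + s) := Metric.infDist_le_dist_of_mem hes
        _ = dist (y - e) s := by
            rw [dist_eq_norm, dist_eq_norm]
            congr 1
            abel
        _ ≤ f (y - e) + η := hds.le
    have hfz : f z ≤ f y + dist z y := Metric.infDist_le_infDist_add_dist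
    have hfr : f (y - e) ≤ M * ℓ (y - e) := hscale _ hreK
    have h5 : M * ℓ (y - e) ≤ M * (θ * ℓ y + δ) := mul_le_mul_of_nonneg_left hℓr hM0
    have h6 : M * (θ * ℓ y) ≤ M * (θ * (1 + ‖ℓ‖ * δ)) :=
      mul_le_mul_of_nonneg_left (mul_le_mul_of_nonneg_left hℓy hθ0) hM0
    have h7 : θ * (M * ‖ℓ‖ * δ) ≤ 1 * (M * ‖ℓ‖ * δ) :=
      mul_le_mul_of_nonneg_right hθ1.le (by positivity)
    nlinarith [hzy.le, hfz, hfy, hfr, h5, h6, h7, hδA, hε'.le]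
  -- hence `M ≤ θ * M`, so `M = 0`
  have hMle : M ≤ θ * M := by
    by_cases hne : (f '' S).Nonempty
    · exact csSup_le hne (by rintro _ ⟨z, hz, rfl⟩; exact hcontr z hz)
    · rw [Set.not_nonempty_iff_eq_empty] at hne
      have hM : M = 0 := by rw [hM_def, hne, Real.sSup_empty]
      rw [hM, mul_zero]
  have hM : M = 0 := by
    refine le_antisymm ?_ hM0
    by_contra h
    push Not at h
    have : θ * M < 1 * M := mul_lt_mul_of_pos_right hθ1 h
    linarith
  -- conclusion
  intro y hy
  have hy0 : f y ≤ 0 := by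
    have := hscale y (subset_closure hy)
    rwa [hM, zero_mul] at this
  exact (hSc.mem_iff_infDist_zero hSne).2 (le_antisymm hy0 Metric.infDist_nonneg)

end Summit.HodgeConjecture.HodgeConjecture.Theorems
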